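import Mathlib.Data.Real.Basic
import Mathlib.Tactic.Linarith
import Mathlib.Tactic.Ring
import Mathlib.Tactic.FieldSimp
import Mathlib.Tactic.Positivity
import HarnessLib

/-!
# QUANT lane R8, T-DEC, leg (III), blob case — `LawDec.GatedSliceMixLaw'`, Q-ALONE side: the scalar inequalities of cell QK (the top `k₂` a `t`-low)

builds on p205010 (kernel theorem, internal audit signed; external expert review pending)

Support file (`--supports stmt-CriticalPhenomena-4575`), QUANT lane seat prim-quant-arm-1 (gen 41), rung R8 of `run/shared/lean/prim/quant/LADDER.md`.
Pure real-arithmetic lemmas (no law, no flow), kept apart from the routing files so that the class theorems of cell QK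
(`…QuantGatedSliceMixLawQKCells`) elaborate fast.  Notation of the memo `quant/prim-quant-arm-1-g41/Q-ALONE-G41.md` §5: `m = 1 − z`,
`A = m(1−λ)(1−g)`, `B = m(1−λ)g`, `C = mλ(1−g)`, `D = mλg`, `S = m(k₁ + λ(k₂ − k₁))`, `t = S + agm`, twin `P = k₁ + a`, `p = P − t`,
`W₂ = t − 2k₂`, `d₂ = P − k₂`, `E = 1 − B − C`.  The certificates (all found / checked exactly, kit jobs j185569 (Positivstellensatz LP) and
the seat's census scripts `work/explore/qQK*.py`):
* `qk_Ic_heavy`, `qk_Ic_light` — the low top SATURATES the twin, everything else rides the giant: `y(z + A + C − cap) ≤ (1−y)D`; heavy form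
  from the identity `yB·d₂ − (y−D)W₂ = λ(mg−y)W₂ + (1−λ)y·X`, `X = 2k₂ − S − mg(k₂−k₁) ≥ 0`; light form from `y ≤ mg = B + D` and `γ ≤ y`.
* `qk_T4` — the y-free endpoint inequality `(t−k₁)(W₂E − d₂D)(p+K) ≤ W₂·p·(B(p+K) − W₂C)`: an explicit sum of eight nonnegative products;
  `qk_Ib_heavyTop` — its affine consequence for `y·d₂ ≤ W₂` (the top heavy at the twin): `(t−k₁)(yE − D)(p+K) ≤ y·p·(B(p+K) − W₂C)`.
* `qk_Ix` — twin at or below `t`, the low `k₁` rides the giant: `y(z + A) ≤ (1−y)D` (case `E ≤ λ` by the threshold, case `E > λ` by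
  top-affordability `y·k₂ ≤ S` and `S·E ≤ k₂·D`).
* `qk_Ib_ll` — both lows light at the twin: the saturation inequality follows from the threshold alone.
HONEST STATUS: `GatedSliceMixLaw'` (regime R), CW, `GateMove`, `GatedConvEmptyFree`, `SingleGateConvClosed`, `TreeDEC`, `FarTreeRow` OPEN; RATE unchanged.

[this work].  Nothing here is cited as a published result.
-/

namespace Summit.CriticalPhenomena.PercolationContinuityZ3.Theorems

namespace Quant

namespace LawDec

/-- `X = 2k₂ − S − mg(k₂ − k₁) ≥ 0`. [this work] -/
theorem qk_X_nonneg (z g lam S k₁ k₂ : ℝ) (hz0 : 0 ≤ z) (hg0 : 0 ≤ g) (hg1 : g ≤ 1) (hlam0 : 0 ≤ lam) (hlam1 : lam ≤ 1)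
    (hk₁ : 0 ≤ k₁) (hk : k₁ ≤ k₂) (hmean : (1 - z) * (k₁ + (k₂ - k₁) * lam) = S) :
    0 ≤ 2 * k₂ - S - (1 - z) * g * (k₂ - k₁) := by
  rw [← hmean]
  have h1 : (1 - z) * (k₁ + (k₂ - k₁) * lam) ≤ k₁ + (k₂ - k₁) := by
    have h2 : (k₂ - k₁) * lam ≤ k₂ - k₁ := mul_le_of_le_one_right (by linarith) hlam1
    have h0 : 0 ≤ k₁ + (k₂ - k₁) * lam := by nlinarith
    calc (1 - z) * (k₁ + (k₂ - k₁) * lam) ≤ 1 * (k₁ + (k₂ - k₁) * lam) := mul_le_mul_of_nonneg_right (by linarith) h0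
      _ ≤ k₁ + (k₂ - k₁) := by linarith
  have h3 : (1 - z) * g * (k₂ - k₁) ≤ k₂ - k₁ := by
    have : (1 - z) * g ≤ 1 := by nlinarith
    nlinarith
  nlinarith

/-- **The low top saturates the twin (heavy pair): everything else fits the giant.**  With `cap·W₂ = B(d₂ − W₂)` (the mass of `k₂` that fills
the twin at the heavy rate `W₂/(d₂ − W₂)`), `y(z + A + C − cap) ≤ (1−y)D`. [this work] -/
theorem qk_Ic_heavy (y z g lam S k₁ k₂ a cap : ℝ) (hy0 : 0 < y) (hz0 : 0 ≤ z) (hg0 : 0 ≤ g) (hg1 : g ≤ 1)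
    (hlam0 : 0 ≤ lam) (hlam1 : lam ≤ 1) (hyg : y ≤ (1 - z) * g) (hk₁ : 0 ≤ k₁) (hk : k₁ ≤ k₂)
    (hmean : (1 - z) * (k₁ + (k₂ - k₁) * lam) = S)
    (hW : 0 < S + a * g * (1 - z) - 2 * k₂)
    (hcap : cap * (S + a * g * (1 - z) - 2 * k₂) = (1 - z) * (1 - lam) * g * ((k₁ + a - k₂) - (S + a * g * (1 - z) - 2 * k₂))) :
    y * (z + (1 - z) * (1 - lam) * (1 - g) + (1 - z) * lam * (1 - g) - cap) ≤ (1 - y) * ((1 - z) * lam * g) := by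
  set W : ℝ := S + a * g * (1 - z) - 2 * k₂ with hW'
  have hX := qk_X_nonneg z g lam S k₁ k₂ hz0 hg0 hg1 hlam0 hlam1 hk₁ hk hmean
  -- the identity `yB·d₂ − (y − D)W = λ(mg − y)W + (1−λ)·y·X`
  have hI : y * ((1 - z) * (1 - lam) * g) * (k₁ + a - k₂) - (y - (1 - z) * lam * g) * W
      = lam * ((1 - z) * g - y) * W + (1 - lam) * y * (2 * k₂ - S - (1 - z) * g * (k₂ - k₁)) := by
    rw [hW', ← hmean]; ring
  have h1 : 0 ≤ lam * ((1 - z) * g - y) * W := mul_nonneg (mul_nonneg hlam0 (by linarith)) hW.le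
  have h2 : 0 ≤ (1 - lam) * y * (2 * k₂ - S - (1 - z) * g * (k₂ - k₁)) := mul_nonneg (mul_nonneg (by linarith) hy0.le) hX
  -- `(y − yB − D)·W ≤ y·cap·W`
  have h3 : (y - y * ((1 - z) * (1 - lam) * g) - (1 - z) * lam * g) * W ≤ y * cap * W := by
    have e : y * cap * W = y * ((1 - z) * (1 - lam) * g) * (k₁ + a - k₂) - y * ((1 - z) * (1 - lam) * g) * W := by
      rw [mul_assoc, hcap]; ring
    rw [e]; nlinarith [hI, h1, h2]
  have h4 : y - y * ((1 - z) * (1 - lam) * g) - (1 - z) * lam * g ≤ y * cap := le_of_mul_le_mul_right h3 hW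
  nlinarith [h4]

/-- **The low top saturates the twin (light pair).**  With `cap·γ = B(1 − γ)` and `0 < γ ≤ y`, `y(z + A + C − cap) ≤ (1−y)D`. [this work] -/
theorem qk_Ic_light (y z g lam γ cap : ℝ) (hy0 : 0 < y) (hz1 : z ≤ 1) (hg0 : 0 ≤ g) (hlam1 : lam ≤ 1)
    (hyg : y ≤ (1 - z) * g) (hγ0 : 0 < γ) (hγy : γ ≤ y)
    (hcap : cap * γ = (1 - z) * (1 - lam) * g * (1 - γ)) :
    y * (z + (1 - z) * (1 - lam) * (1 - g) + (1 - z) * lam * (1 - g) - cap) ≤ (1 - y) * ((1 - z) * lam * g) := by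
  have hB0 : 0 ≤ (1 - z) * (1 - lam) * g := mul_nonneg (mul_nonneg (by linarith) (by linarith)) hg0
  -- `(y − D)γ ≤ yB`
  have h1 : (y - (1 - z) * lam * g) * γ ≤ y * ((1 - z) * (1 - lam) * g) := by
    by_cases hyD : y ≤ (1 - z) * lam * g
    · have : (y - (1 - z) * lam * g) * γ ≤ 0 := mul_nonpos_of_nonpos_of_nonneg (by linarith) hγ0.le
      linarith [mul_nonneg hy0.le hB0]
    · have h2 : (y - (1 - z) * lam * g) * γ ≤ (y - (1 - z) * lam * g) * y :=
        mul_le_mul_of_nonneg_left hγy (by linarith)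
      have h3 : y - (1 - z) * lam * g ≤ (1 - z) * (1 - lam) * g := by nlinarith
      nlinarith
  have h3 : (y - y * ((1 - z) * (1 - lam) * g) - (1 - z) * lam * g) * γ ≤ y * cap * γ := by
    have e : y * cap * γ = y * ((1 - z) * (1 - lam) * g) - y * ((1 - z) * (1 - lam) * g) * γ := by
      rw [mul_assoc, hcap]; ring
    rw [e]; nlinarith [h1]
  have h4 : y - y * ((1 - z) * (1 - lam) * g) - (1 - z) * lam * g ≤ y * cap := le_of_mul_le_mul_right h3 hγ0
  nlinarith [h4]

/-- **The y-free endpoint inequality `T4 ≥ 0`** (kit j185569: an explicit sum of eight nonnegative products).  With `K = k₂`, `P = k₁ + a`,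
`p = P − t`, `W₂ = t − 2K`, `d₂ = P − K`, `E = 1 − B − C`:  `(t−k₁)(W₂E − d₂D)(p+K) ≤ W₂·p·(B(p+K) − W₂C)`. [this work] -/
theorem qk_T4 (z g lam S k₁ k₂ a : ℝ) (hz0 : 0 ≤ z) (hz1 : z ≤ 1) (hg0 : 0 ≤ g) (hg1 : g ≤ 1) (hlam0 : 0 ≤ lam)
    (hk₁ : 0 ≤ k₁) (hk : k₁ ≤ k₂) (hmean : (1 - z) * (k₁ + (k₂ - k₁) * lam) = S)
    (hW : 0 ≤ S + a * g * (1 - z) - 2 * k₂) (hpK : 0 ≤ k₁ + a - (S + a * g * (1 - z)) + k₂) :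
    ((S + a * g * (1 - z)) - k₁) * ((S + a * g * (1 - z) - 2 * k₂) * (1 - (1 - z) * (1 - lam) * g - (1 - z) * lam * (1 - g))
        - (k₁ + a - k₂) * ((1 - z) * lam * g)) * (k₁ + a - (S + a * g * (1 - z)) + k₂)
      ≤ (S + a * g * (1 - z) - 2 * k₂) * (k₁ + a - (S + a * g * (1 - z)))
          * ((1 - z) * (1 - lam) * g * (k₁ + a - (S + a * g * (1 - z)) + k₂) - (S + a * g * (1 - z) - 2 * k₂) * ((1 - z) * lam * (1 - g))) := by
  set W : ℝ := S + a * g * (1 - z) - 2 * k₂ with hW'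
  set q : ℝ := k₁ + a - (S + a * g * (1 - z)) + k₂ with hq
  set C : ℝ := (1 - z) * lam * (1 - g) with hC
  set D : ℝ := (1 - z) * lam * g with hD
  have hC0 : 0 ≤ C := mul_nonneg (mul_nonneg (by linarith) hlam0) (by linarith)
  have hD0 : 0 ≤ D := mul_nonneg (mul_nonneg (by linarith) hlam0) hg0
  have hd0 : 0 ≤ k₂ - k₁ := by linarith
  -- the certificate
  have hcert : W * (k₁ + a - (S + a * g * (1 - z))) * ((1 - z) * (1 - lam) * g * q - W * C)
      - ((S + a * g * (1 - z)) - k₁) * (W * (1 - (1 - z) * (1 - lam) * g - C) - (k₁ + a - k₂) * D) * q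
      = z * k₁ * q * W + k₁ * C * q * W + k₁ * C * W * W + k₁ * D * q * q + k₁ * D * q * W
        + (k₂ - k₁) * C * q * W + (k₂ - k₁) * C * W * W + 2 * ((k₂ - k₁) * D * q * q) := by
    rw [hW', hq, hC, hD, ← hmean]; ring
  have h1 : 0 ≤ z * k₁ * q * W := by positivity
  have h2 : 0 ≤ k₁ * C * q * W := by positivity
  have h3 : 0 ≤ k₁ * C * W * W := by positivity
  have h4 : 0 ≤ k₁ * D * q * q := by positivity
  have h5 : 0 ≤ k₁ * D * q * W := by positivity
  have h6 : 0 ≤ (k₂ - k₁) * C * q * W := by positivity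
  have h7 : 0 ≤ (k₂ - k₁) * C * W * W := by positivity
  have h8 : 0 ≤ (k₂ - k₁) * D * q * q := by positivity
  linarith [hcert, h1, h2, h3, h4, h5, h6, h7, h8]

/-- **The top HEAVY at the twin (`y·d₂ ≤ W₂`): `(t−k₁)(yE − D)(p+K) ≤ y·p·(B(p+K) − W₂C)`** — affine in `y`, nonnegative at `y = 0`
(`(t−k₁)D(p+K) ≥ 0`) and at `y = W₂/d₂` (`qk_T4`). [this work] -/
theorem qk_Ib_heavyTop (y z g lam S k₁ k₂ a : ℝ) (hy0 : 0 ≤ y) (hz0 : 0 ≤ z) (hz1 : z ≤ 1) (hg0 : 0 ≤ g) (hg1 : g ≤ 1)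
    (hlam0 : 0 ≤ lam) (hk₁ : 0 ≤ k₁) (hk : k₁ ≤ k₂) (hmean : (1 - z) * (k₁ + (k₂ - k₁) * lam) = S)
    (hW : 0 < S + a * g * (1 - z) - 2 * k₂) (hpK : 0 ≤ k₁ + a - (S + a * g * (1 - z)) + k₂)
    (hheavy : y * (k₁ + a - k₂) ≤ S + a * g * (1 - z) - 2 * k₂) :
    ((S + a * g * (1 - z)) - k₁) * (y * (1 - (1 - z) * (1 - lam) * g - (1 - z) * lam * (1 - g)) - (1 - z) * lam * g)
        * (k₁ + a - (S + a * g * (1 - z)) + k₂)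
      ≤ y * (k₁ + a - (S + a * g * (1 - z)))
          * ((1 - z) * (1 - lam) * g * (k₁ + a - (S + a * g * (1 - z)) + k₂) - (S + a * g * (1 - z) - 2 * k₂) * ((1 - z) * lam * (1 - g))) := by
  have hT4 := qk_T4 z g lam S k₁ k₂ a hz0 hz1 hg0 hg1 hlam0 hk₁ hk hmean hW.le hpK
  set t : ℝ := S + a * g * (1 - z) with ht
  set W : ℝ := S + a * g * (1 - z) - 2 * k₂ with hW'
  set q : ℝ := k₁ + a - (S + a * g * (1 - z)) + k₂ with hq
  set p : ℝ := k₁ + a - (S + a * g * (1 - z)) with hp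
  set B : ℝ := (1 - z) * (1 - lam) * g with hB
  set C : ℝ := (1 - z) * lam * (1 - g) with hC
  set D : ℝ := (1 - z) * lam * g with hD
  set E : ℝ := 1 - B - C with hE
  have hD0 : 0 ≤ D := mul_nonneg (mul_nonneg (by linarith) hlam0) hg0
  -- `f(y) := y·p·(Bq − WC) − (t−k₁)(yE − D)q` is affine: `W·f(y) = (W − y·d₂)·f(0) + y·(d₂·f(W/d₂))`, `d₂ f(W/d₂) = T4`
  have haff : W * (y * p * (B * q - W * C) - (t - k₁) * (y * E - D) * q)
      = (W - y * (k₁ + a - k₂)) * ((t - k₁) * D * q) + y * (W * p * (B * q - W * C) - (t - k₁) * (W * E - (k₁ + a - k₂) * D) * q) := by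
    ring
  have hf0 : 0 ≤ (t - k₁) * D * q := mul_nonneg (mul_nonneg (by rw [ht]; linarith) hD0) hpK
  have h1 : 0 ≤ (W - y * (k₁ + a - k₂)) * ((t - k₁) * D * q) := mul_nonneg (by linarith) hf0
  have h2 : 0 ≤ y * (W * p * (B * q - W * C) - (t - k₁) * (W * E - (k₁ + a - k₂) * D) * q) := mul_nonneg hy0 (by linarith [hT4])
  have h3 : 0 ≤ W * (y * p * (B * q - W * C) - (t - k₁) * (y * E - D) * q) := by rw [haff]; exact add_nonneg h1 h2
  have h4 : 0 ≤ y * p * (B * q - W * C) - (t - k₁) * (y * E - D) * q := by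
    by_contra hc
    have : W * (y * p * (B * q - W * C) - (t - k₁) * (y * E - D) * q) < 0 := mul_neg_of_pos_of_neg hW (not_le.1 hc)
    linarith
  linarith

/-- **Twin at or below `t`: the low `k₁` rides the giant — `y(z + A) ≤ (1−y)D`.**  Hypotheses: threshold `y ≤ (1−z)g`, top-affordability
`y·k₂ ≤ S`, `k₂ + 1 ≤ a` (the top is a `t`-low), the twin at or below `t` (`k₁ + a ≤ t`).  Case `E ≤ λ`: `yE ≤ mgE ≤ mgλ = D`.  Case `E > λ`:
`S·E ≤ k₂·D` (from `k₁ ≤ a − 1 − (k₂−k₁)`, `(E−λ)(E−D) ≥ 0` and `a(1 − gm) ≤ mλ(k₂−k₁)`), then `y·E ≤ (S/k₂)E ≤ D`. [this work] -/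
theorem qk_Ix (y z g lam S k₁ k₂ a : ℝ) (hz0 : 0 ≤ z) (hz1 : z < 1) (hg0 : 0 ≤ g) (hg1 : g ≤ 1)
    (hlam0 : 0 ≤ lam) (hlam1 : lam ≤ 1) (hyg : y ≤ (1 - z) * g) (hk₁ : 0 ≤ k₁) (hk : k₁ ≤ k₂) (hk₂ : 0 < k₂)
    (hmean : (1 - z) * (k₁ + (k₂ - k₁) * lam) = S) (hta : y * k₂ ≤ S) (hKa : k₂ + 1 ≤ a)
    (hPt : k₁ + a ≤ S + a * g * (1 - z)) :
    y * (z + (1 - z) * (1 - lam) * (1 - g)) ≤ (1 - y) * ((1 - z) * lam * g) := by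
  set m : ℝ := 1 - z with hm
  set A : ℝ := m * (1 - lam) * (1 - g) with hA
  set B : ℝ := m * (1 - lam) * g with hB
  set C : ℝ := m * lam * (1 - g) with hC
  set D : ℝ := m * lam * g with hD
  set E : ℝ := 1 - B - C with hE
  have hm0 : 0 < m := by rw [hm]; linarith
  have hm1 : m ≤ 1 := by rw [hm]; linarith
  have hA0 : 0 ≤ A := mul_nonneg (mul_nonneg hm0.le (by linarith)) (by linarith)
  have hD0 : 0 ≤ D := mul_nonneg (mul_nonneg hm0.le hlam0) hg0
  have hEz : E = z + A + D := by rw [hE, hA, hB, hC, hD, hm]; ring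
  have hE0 : 0 ≤ E := by rw [hEz]; exact add_nonneg (add_nonneg hz0 hA0) hD0
  -- goal ⟺ `y·E ≤ D`
  suffices h : y * E ≤ D by rw [hEz] at h; nlinarith [h]
  by_cases hα : E ≤ lam
  · -- threshold
    calc y * E ≤ m * g * E := mul_le_mul_of_nonneg_right (by rw [hm]; linarith) hE0
      _ ≤ m * g * lam := mul_le_mul_of_nonneg_left hα (mul_nonneg hm0.le hg0)
      _ = D := by rw [hD]; ring
  · have hα' : lam < E := not_le.1 hα
    set δ : ℝ := k₂ - k₁ with hδ
    have hδ0 : 0 ≤ δ := by rw [hδ]; linarith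
    -- (H): `a(1 − gm) ≤ mλδ − z k₁`
    have hH : a * (1 - g * m) ≤ m * lam * δ - z * k₁ := by
      have e : S = m * k₁ + m * lam * δ := by rw [← hmean, hδ]; ring
      rw [e] at hPt
      have : a * g * (1 - z) = a * g * m := by rw [hm]
      nlinarith [hPt]
    -- `mλ > 0` (else `g = m = 1` by (H) and then `E = 0 ≤ λ`)
    have hml : 0 < m * lam := by
      rcases lt_or_eq_of_le hlam0 with hl | hl
      · exact mul_pos hm0 hl
      · exfalso
        rw [← hl] at hH hα'
        have h1 : a * (1 - g * m) ≤ 0 := by nlinarith [mul_nonneg hz0 hk₁]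
        have ha1 : 1 ≤ a := by linarith
        have h2 : 1 - g * m ≤ 0 := by
          by_contra hc
          have : 0 < a * (1 - g * m) := mul_pos (by linarith) (not_le.1 hc)
          linarith
        have hE' : E = 1 - g * m := by rw [hE, hB, hC, ← hl]; ring
        rw [hE'] at hα'
        linarith
    have hEg : 0 ≤ E - lam * g := by
      have e : E - lam * g = z * (1 - lam * g) + m * (1 - lam) * (1 - g) := by rw [hE, hB, hC, hm]; ring
      rw [e]
      exact add_nonneg (mul_nonneg hz0 (by nlinarith)) (mul_nonneg (mul_nonneg hm0.le (by linarith)) (by linarith))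
    -- (iii): `mλ(E − λg) ≤ (1 − gm)(1−λ)E`, from `(E − λ)(E − D) ≥ 0`
    have hiii : m * lam * (E - lam * g) ≤ (1 - g * m) * (1 - lam) * E := by
      have e : (1 - g * m) * (1 - lam) * E - m * lam * (E - lam * g) = (E - lam) * (E - D) := by
        rw [hE, hB, hC, hD]; ring
      have hED : 0 ≤ E - D := by rw [hEz]; linarith
      nlinarith [mul_nonneg (sub_nonneg.2 hα'.le) hED]
    -- hence `(a − 1)(E − λg) ≤ δ(1−λ)E`
    have hgm : 0 ≤ 1 - g * m := by nlinarith
    have hstep : (a - 1) * (E - lam * g) ≤ δ * (1 - lam) * E := by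
      have ha1 : (0 : ℝ) ≤ a - 1 := by linarith
      have hZ0 : 0 ≤ (1 - g * m) * (1 - lam) * E := mul_nonneg (mul_nonneg hgm (by linarith)) hE0
      have h1 : (a - 1) * (m * lam * (E - lam * g)) ≤ (a - 1) * ((1 - g * m) * (1 - lam) * E) :=
        mul_le_mul_of_nonneg_left hiii ha1
      have h4 : a * (1 - g * m) ≤ m * lam * δ := by linarith [hH, mul_nonneg hz0 hk₁]
      have h3 : a * (1 - g * m) * ((1 - lam) * E) ≤ m * lam * δ * ((1 - lam) * E) :=
        mul_le_mul_of_nonneg_right h4 (mul_nonneg (by linarith) hE0)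
      have h5 : m * lam * ((a - 1) * (E - lam * g)) ≤ m * lam * (δ * (1 - lam) * E) := by
        have e1 : (a - 1) * (m * lam * (E - lam * g)) = m * lam * ((a - 1) * (E - lam * g)) := by ring
        have e2 : (a - 1) * ((1 - g * m) * (1 - lam) * E) = a * (1 - g * m) * ((1 - lam) * E) - (1 - g * m) * (1 - lam) * E := by ring
        have e3 : m * lam * δ * ((1 - lam) * E) = m * lam * (δ * (1 - lam) * E) := by ring
        linarith [h1, h3, hZ0, e1, e2, e3]
      exact le_of_mul_le_mul_left h5 hml
    -- `k₁(E − λg) + δλ(E − g) ≤ 0`, i.e. `S·E ≤ k₂·D`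
    have hk₁le : k₁ ≤ a - 1 - δ := by rw [hδ]; linarith
    have hβ : k₁ * (E - lam * g) + δ * lam * (E - g) ≤ 0 := by
      have h1 : k₁ * (E - lam * g) ≤ (a - 1 - δ) * (E - lam * g) := mul_le_mul_of_nonneg_right hk₁le hEg
      have e : (a - 1 - δ) * (E - lam * g) + δ * lam * (E - g) = (a - 1) * (E - lam * g) - δ * (1 - lam) * E := by ring
      linarith [h1, e, hstep]
    have hSE : S * E ≤ k₂ * D := by
      have e : S * E - k₂ * D = m * (k₁ * (E - lam * g) + δ * lam * (E - g)) := by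
        rw [← hmean, hD, hδ]; ring
      linarith [e, mul_nonpos_of_nonneg_of_nonpos hm0.le hβ]
    -- `k₂·(yE) ≤ S·E ≤ k₂·D`
    have h6 : k₂ * (y * E) ≤ k₂ * D := by
      have : k₂ * (y * E) = (y * k₂) * E := by ring
      rw [this]
      exact (mul_le_mul_of_nonneg_right hta hE0).trans hSE
    exact le_of_mul_le_mul_left h6 hk₂

/-- **Both lows light at the twin: the saturation inequality follows from the threshold.**  If `U₁, U₂ ≤ y/(1−y)`, `0 ≤ yE − D`, `U₂C ≤ B`
and `y ≤ B + D`, then `U₁(yE − D) ≤ y(B − U₂C)` (`E = 1 − B − C`). [this work] -/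
theorem qk_Ib_ll (y B C D U₁ U₂ : ℝ) (hy0 : 0 < y) (hy1 : y < 1) (hC0 : 0 ≤ C)
    (hU₁ : U₁ ≤ y / (1 - y)) (hU₂ : U₂ ≤ y / (1 - y)) (hpos : 0 ≤ y * (1 - B - C) - D) (hthr : y ≤ B + D) :
    U₁ * (y * (1 - B - C) - D) ≤ y * (B - U₂ * C) := by
  have h1y : 0 < 1 - y := by linarith
  have h1 : U₁ * (y * (1 - B - C) - D) ≤ y / (1 - y) * (y * (1 - B - C) - D) := mul_le_mul_of_nonneg_right hU₁ hpos
  have h2 : y * (B - y / (1 - y) * C) ≤ y * (B - U₂ * C) := by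
    apply mul_le_mul_of_nonneg_left _ hy0.le
    nlinarith [mul_le_mul_of_nonneg_right hU₂ hC0]
  have h3 : y / (1 - y) * (y * (1 - B - C) - D) ≤ y * (B - y / (1 - y) * C) := by
    have key : (1 - y) * (y * (B - y / (1 - y) * C) - y / (1 - y) * (y * (1 - B - C) - D)) = y * (B + D - y) := by
      field_simp
      ring
    have h4 : 0 ≤ (1 - y) * (y * (B - y / (1 - y) * C) - y / (1 - y) * (y * (1 - B - C) - D)) := by
      rw [key]; exact mul_nonneg hy0.le (by linarith)
    have h5 : 0 ≤ y * (B - y / (1 - y) * C) - y / (1 - y) * (y * (1 - B - C) - D) := by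
      by_contra hc
      have : (1 - y) * (y * (B - y / (1 - y) * C) - y / (1 - y) * (y * (1 - B - C) - D)) < 0 :=
        mul_neg_of_pos_of_neg h1y (not_le.1 hc)
      linarith
    linarith
  linarith

end LawDec

end Quant

end Summit.CriticalPhenomena.PercolationContinuityZ3.Theorems
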